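import Literature.Geometry.Lorentzian.VacuumLocalLimit
import Literature.Geometry.Lorentzian.TameChartCompactnessFramed
import HarnessLib

/-!
# Framed chart limits of vacuum spacetimes are vacuum

The framed version of `VacuumLocalLimit.lean`: if smooth charts `Ψₙ : ↥O → 𝓢ₙ` of RICCI-FLAT
spacetimes are pinched in a frame field `𝔉` (`‖A⁻¹* gₙ − η‖ < 1`, hence immersions) and their
components converge in `C²` at every point of `O` to the components `G` of a near-framed chart
`L : NearFramedChart O 𝔉`, then the near-framed chart spacetime `L.spacetime` is Ricci-flat
(`NearFramedChart.isRicciFlat_spacetime_of_tendsto`) — the coordinate Ricci form is continuous in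
the `2`-jet (`Spacetime.ricAt_eq_zero_of_tendsto_metricInCoords`) and the Ricci tensor of the
`OpensChart` metric `G` is its coordinate Ricci form. Combined with the framed local Cheeger–Gromov
compactness theorem this gives `Spacetime.exists_nearFramedChart_subconvergesLocallyTo_isRicciFlat`:
horizon-reaching single-chart limits of vacuum spacetimes close to Kerr in the Kerr–Schild frame
are vacuum.

## References
* P. Petersen, *Riemannian Geometry*, 2nd ed., Springer 2006, Ch. 10 §3.2. [Petersen2006]
* B. O'Neill, *Semi-Riemannian geometry*, Academic Press 1983, Ch. 3, Lemma 3.52, Prop. 3.59. [ONeill1983]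
-/

noncomputable section

open Set Filter TopologicalSpace Bundle Function
open scoped Manifold ContDiff Topology ENNReal

universe u

set_option maxSynthPendingDepth 3

namespace Literature.Geometry.Lorentzian

/-! ### The near-framed chart spacetime: Ricci tensor = coordinate Ricci form of `G` -/

namespace NearFramedChart

variable {O : Opens E4} {𝔉 : FrameField O} (L : NearFramedChart O 𝔉) (hO : IsConnected (O : Set E4))

/-- **The Ricci tensor of the near-framed chart SPACETIME is the coordinate Ricci form of `G`**
(its metric is the `OpensChart` metric with components `G`). [cite: ONeill1983, Ch. 3, Lemma 3.52] -/
theorem ricci_spacetime_eq_ricAt [inst : (L.spacetime hO).metric.toPseudoRiemannianMetric.HasLeviCivita]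
    (x : O) (Y Z : E4) :
    (L.spacetime hO).metric.toPseudoRiemannianMetric.ricci x Y Z = MetricCoord.ricAt L.G x Y Z := by
  haveI : L.metric.toPseudoRiemannianMetric.HasLeviCivita := inst
  exact OpensChart.ricci_eq_ricAt (g := L.metric.toPseudoRiemannianMetric) (fun _ ↦ rfl) x Y Z

/-- **Ricci-flatness of the near-framed chart spacetime from `ricAt G = 0` on `O`.**
[cite: ONeill1983, Ch. 3, Lemma 3.52] -/
theorem isRicciFlat_spacetime_of_ricAt_eqOn_zero (h : EqOn (MetricCoord.ricAt L.G) 0 (O : Set E4))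
    [(L.spacetime hO).metric.toPseudoRiemannianMetric.HasLeviCivita] :
    (L.spacetime hO).metric.toPseudoRiemannianMetric.IsRicciFlat := by
  intro x
  ext Y Z
  rw [L.ricci_spacetime_eq_ricAt hO x Y Z, h x.2]
  rfl

end NearFramedChart

/-! ### Framed pinching gives immersions -/

namespace Spacetime

variable (𝓢 : Spacetime.{u} 4) {O : Opens E4} (𝔉 : FrameField O)

/-- A smooth chart pinched in a frame has injective differentials. [cite: ONeill1983, Ch. 5, Lemma 5.26] -/
theorem injective_mfderiv_of_norm_framedDeviation_lt_one (Ψ : O → 𝓢.carrier)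
    (hΨ : ContMDiff 𝓘(ℝ, E4) (𝓡 4) ∞ Ψ) (x₀ : O)
    (h : ∀ y ∈ (O : Set E4), ‖𝓢.framedDeviation 𝔉 Ψ x₀ y‖ < 1) (z : O) :
    Injective (mfderiv 𝓘(ℝ, E4) (𝓡 4) Ψ z) := by
  have hd : MDifferentiableAt 𝓘(ℝ, E4) (𝓡 4) Ψ ⟨z.1, z.2⟩ := (hΨ z).mdifferentiableAt (by simp)
  have hz : ‖framedBilin (𝓢.metricInCoords (Ψ ∘ (chartAt E4 z).symm)) 𝔉.Ainv z - Minkowski.bilin‖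
      < 1 := by
    have h1 := h z z.2
    rw [𝓢.framedDeviation_eq 𝔉 Ψ x₀ z] at h1
    exact h1
  have hinj := 𝓢.injective_mfderiv_of_metricInCoords_nondegenerate
    (𝓢.metricInCoords_nondegenerate_of_norm_framed_sub_lt_one 𝔉 z.2 hz)
  intro v w hvw
  apply hinj
  have e1 := 𝓢.mfderiv_comp_chartAt_symm_apply (Minkowski.backgroundOn O) Ψ z z.2 hd v
  have e2 := 𝓢.mfderiv_comp_chartAt_symm_apply (Minkowski.backgroundOn O) Ψ z z.2 hd w
  exact e1.trans (hvw.trans e2.symm)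

end Spacetime

/-! ### Vacuum passes to framed limits -/

namespace NearFramedChart

variable {𝓢ₙ : ℕ → Spacetime.{u} 4} {O : Opens E4} {𝔉 : FrameField O}

/-- **Framed chart limits of vacuum spacetimes are vacuum** (module docstring).
[cite: Petersen2006, Ch. 10 §3.2] -/
theorem isRicciFlat_spacetime_of_tendsto (hO : IsConnected (O : Set E4))
    (Ψ : ∀ n, O → (𝓢ₙ n).carrier) (hΨ : ∀ n, ContMDiff 𝓘(ℝ, E4) (𝓡 4) ∞ (Ψ n)) (z₀ : O)
    (hpinch : ∀ n, ∀ y ∈ (O : Set E4), ‖(𝓢ₙ n).framedDeviation 𝔉 (Ψ n) z₀ y‖ < 1)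
    (hvac : ∀ n, ∀ [(𝓢ₙ n).metric.toPseudoRiemannianMetric.HasLeviCivita],
      (𝓢ₙ n).metric.toPseudoRiemannianMetric.IsRicciFlat)
    (L : NearFramedChart O 𝔉) {φ : ℕ → ℕ}
    (hlim : ∀ y ∈ (O : Set E4), Tendsto (fun j ↦ supCkENorm ({y} : Set E4) 2
      ((𝓢ₙ (φ j)).metricInCoords (Ψ (φ j) ∘ (chartAt E4 z₀).symm) - L.G)) atTop (𝓝 0))
    [(L.spacetime hO).metric.toPseudoRiemannianMetric.HasLeviCivita] :
    (L.spacetime hO).metric.toPseudoRiemannianMetric.IsRicciFlat :=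
  L.isRicciFlat_spacetime_of_ricAt_eqOn_zero hO fun _ hy ↦
    Spacetime.ricAt_eq_zero_of_tendsto_metricInCoords Ψ hΨ
      (fun n ↦ (𝓢ₙ n).injective_mfderiv_of_norm_framedDeviation_lt_one 𝔉 (Ψ n) (hΨ n) z₀
        (hpinch n))
      hvac L.contDiffOn (OpensChart.isMetricOn_repr (g := L.metric.toPseudoRiemannianMetric) fun _ ↦ rfl)
      z₀ hlim hy

end NearFramedChart

namespace Spacetime

variable {𝓢ₙ : ℕ → Spacetime.{u} 4} {pₙ : ∀ n, (𝓢ₙ n).carrier} {O : Opens E4} {𝔉 : FrameField O}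

/-- **Framed local Cheeger–Gromov compactness for tame VACUUM spacetimes: the limit is vacuum.**
Under the hypotheses of `exists_nearFramedChart_subconvergesLocallyTo`, if every `𝓢ₙ` is
Ricci-flat then the near-framed chart spacetime of the limit components is Ricci-flat, besides
being a pointed `Cᵏ_loc` limit for every `k`. [cite: Petersen2006, Ch. 10 §3.2] -/
theorem exists_nearFramedChart_subconvergesLocallyTo_isRicciFlat (hO : IsConnected (O : Set E4))
    {y₀ : E4} (hy₀ : y₀ ∈ (O : Set E4)) (Ψ : ∀ n, O → (𝓢ₙ n).carrier)
    (hΨ : ∀ n, ContMDiff 𝓘(ℝ, E4) (𝓡 4) ∞ (Ψ n)) (hinj : ∀ n, Injective (Ψ n))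
    (hcentre : ∀ n, Ψ n ⟨y₀, hy₀⟩ = pₙ n)
    (hfut : ∀ n, (𝓢ₙ n).timeOrientation.IsFutureDirected
      (mfderiv 𝓘(ℝ, E4) (𝓡 4) (Ψ n) ⟨y₀, hy₀⟩ (𝔉.Ainv y₀ (E4.basisVector 0))))
    {θ : ℝ} (hθ : θ < 1)
    (hpinch : ∀ n, ∀ y ∈ (O : Set E4), ‖(𝓢ₙ n).framedDeviation 𝔉 (Ψ n) ⟨y₀, hy₀⟩ y‖ ≤ θ)
    (hbound : ∀ k : ℕ, ∃ Λ : ℝ≥0∞, Λ ≠ ⊤ ∧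
      ∀ n, supCkENorm (O : Set E4) k ((𝓢ₙ n).framedDeviation 𝔉 (Ψ n) ⟨y₀, hy₀⟩) ≤ Λ)
    (hvac : ∀ n, ∀ [(𝓢ₙ n).metric.toPseudoRiemannianMetric.HasLeviCivita],
      (𝓢ₙ n).metric.toPseudoRiemannianMetric.IsRicciFlat) :
    ∃ (L : NearFramedChart O 𝔉) (φ : ℕ → ℕ), StrictMono φ ∧
      (∀ y ∈ (O : Set E4), ‖L.framed.G y - Minkowski.bilin‖ ≤ θ) ∧
      (∀ (k : ℕ) (C : ℝ≥0∞), (∀ n, supCkENorm (O : Set E4) k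
          ((𝓢ₙ n).framedDeviation 𝔉 (Ψ n) ⟨y₀, hy₀⟩) ≤ C) →
        supCkENorm (O : Set E4) k (L.framed.G - fun _ ↦ Minkowski.bilin) ≤ C) ∧
      (∀ (k : ℕ), ∀ K ⊆ (O : Set E4), IsCompact K →
        Tendsto (fun j ↦ supCkENorm K k
          ((𝓢ₙ (φ j)).framedDeviation 𝔉 (Ψ (φ j)) ⟨y₀, hy₀⟩ - (L.framed.G - fun _ ↦ Minkowski.bilin)))
          atTop (𝓝 0)) ∧
      (∀ k : ℕ, SubconvergesLocallyTo 𝓢ₙ pₙ (L.spacetime hO) ⟨y₀, hy₀⟩ k) ∧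
      ∀ [(L.spacetime hO).metric.toPseudoRiemannianMetric.HasLeviCivita],
        (L.spacetime hO).metric.toPseudoRiemannianMetric.IsRicciFlat := by
  obtain ⟨L, φ, hφ, hGpinch, hbd, hconvDev, hconvG, hsub⟩ :=
    exists_nearFramedChart_subconvergesLocallyTo hO hy₀ Ψ hΨ hinj hcentre hfut hθ hpinch hbound
  refine ⟨L, φ, hφ, hGpinch, hbd, hconvDev, hsub, ?_⟩
  intro _
  exact L.isRicciFlat_spacetime_of_tendsto hO Ψ hΨ ⟨y₀, hy₀⟩
    (fun n y hy ↦ (hpinch n y hy).trans_lt hθ) hvac (φ := φ) fun y hy ↦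
      hconvG 2 {y} (singleton_subset_iff.2 hy) isCompact_singleton

set_option synthInstance.maxHeartbeats 60000 in
/-- **Locally bounded form**: under the hypotheses of
`exists_nearFramedChart_subconvergesLocallyTo_of_locallyBounded`, if every `𝓢ₙ` is Ricci-flat then
the near-framed limit spacetime is Ricci-flat. [cite: Petersen2006, Ch. 10 §3.2] -/
theorem exists_nearFramedChart_subconvergesLocallyTo_isRicciFlat_of_locallyBounded
    (hO : IsConnected (O : Set E4))
    {y₀ : E4} (hy₀ : y₀ ∈ (O : Set E4)) (Ψ : ∀ n, O → (𝓢ₙ n).carrier)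
    (hΨ : ∀ n, ContMDiff 𝓘(ℝ, E4) (𝓡 4) ∞ (Ψ n)) (hinj : ∀ n, Injective (Ψ n))
    (hcentre : ∀ n, Ψ n ⟨y₀, hy₀⟩ = pₙ n)
    (hfut : ∀ n, (𝓢ₙ n).timeOrientation.IsFutureDirected
      (mfderiv 𝓘(ℝ, E4) (𝓡 4) (Ψ n) ⟨y₀, hy₀⟩ (𝔉.Ainv y₀ (E4.basisVector 0))))
    {θ : ℝ} (hθ : θ < 1)
    (hpinch : ∀ n, ∀ y ∈ (O : Set E4), ‖(𝓢ₙ n).framedDeviation 𝔉 (Ψ n) ⟨y₀, hy₀⟩ y‖ ≤ θ)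
    (hb : ∀ (i : ℕ), ∀ K ⊆ (O : Set E4), IsCompact K → ∃ Λ : ℝ, ∀ n, ∀ z ∈ K,
      ‖iteratedFDeriv ℝ i ((𝓢ₙ n).framedDeviation 𝔉 (Ψ n) ⟨y₀, hy₀⟩) z‖ ≤ Λ)
    (hvac : ∀ n, ∀ [(𝓢ₙ n).metric.toPseudoRiemannianMetric.HasLeviCivita],
      (𝓢ₙ n).metric.toPseudoRiemannianMetric.IsRicciFlat) :
    ∃ (L : NearFramedChart O 𝔉) (φ : ℕ → ℕ), StrictMono φ ∧
      (∀ y ∈ (O : Set E4), ‖L.framed.G y - Minkowski.bilin‖ ≤ θ) ∧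
      (∀ (k : ℕ), ∀ K ⊆ (O : Set E4), IsCompact K →
        Tendsto (fun j ↦ supCkENorm K k
          ((𝓢ₙ (φ j)).framedDeviation 𝔉 (Ψ (φ j)) ⟨y₀, hy₀⟩ - (L.framed.G - fun _ ↦ Minkowski.bilin)))
          atTop (𝓝 0)) ∧
      (∀ (k : ℕ), ∀ K ⊆ (O : Set E4), IsCompact K →
        Tendsto (fun j ↦ supCkENorm K k
          ((𝓢ₙ (φ j)).metricInCoords (Ψ (φ j) ∘ (chartAt E4 (⟨y₀, hy₀⟩ : O)).symm) - L.G))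
          atTop (𝓝 0)) ∧
      (∀ k : ℕ, SubconvergesLocallyTo 𝓢ₙ pₙ (L.spacetime hO) ⟨y₀, hy₀⟩ k) ∧
      ∀ [(L.spacetime hO).metric.toPseudoRiemannianMetric.HasLeviCivita],
        (L.spacetime hO).metric.toPseudoRiemannianMetric.IsRicciFlat := by
  obtain ⟨L, φ, hφ, hGpinch, hconvDev, hconvG, hsub⟩ :=
    exists_nearFramedChart_subconvergesLocallyTo_of_locallyBounded hO hy₀ Ψ hΨ hinj hcentre hfut hθ
      hpinch hb
  refine ⟨L, φ, hφ, hGpinch, hconvDev, hconvG, hsub, ?_⟩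
  intro _
  exact L.isRicciFlat_spacetime_of_tendsto hO Ψ hΨ ⟨y₀, hy₀⟩
    (fun n y hy ↦ (hpinch n y hy).trans_lt hθ) hvac (φ := φ) fun y hy ↦
      hconvG 2 {y} (singleton_subset_iff.2 hy) isCompact_singleton

end Spacetime


end Literature.Geometry.Lorentzian

end
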